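import Literature.NumberTheory.LFunctions.ZetaScrewThm17Proofs
import HarnessLib

/-!
# Mellin transforms of back-shifted, cut-off copies of Suzuki's screw function (plumbing for the
RH-free crux `ScrewFejerWindow.WindowLandau`, stmt-RiemannHypothesis-23967, route `ScrewFejerWindow`)

`Ψ = zetaScrew` is Suzuki's screw function of `ζ` (Suzuki 2023, arXiv:2206.03682, (1.1)); the tree's
Landau transform is `Landau.mellinIoi g s = ∫_1^∞ g(x) x^{-(s+1)} dx`.  For a lag `a ≥ 0` the
back-shifted, cut-off copy `y ↦ 𝟙_{y > e^a} Ψ(log y − a)` of `Ψ∘log` is measurable, its Mellin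
integrand converges absolutely for real `σ > 1/2` (Suzuki2023 Thm 1.1 (1), tree
`ZetaScrewLandau.integrableOn_zetaScrew_log_rpow`, after `y = e^a x`), and the **shift rule**
`∫_1^∞ 𝟙_{y>e^a} Ψ(log y − a) y^{-(s+1)} dy = e^{-as} ∫_1^∞ Ψ(log x) x^{-(s+1)} dx` holds (in the
Laplace variable: `∫_a^∞ Ψ(t − a) e^{-st} dt = e^{-as} ∫_0^∞ Ψ(t) e^{-st} dt`).  Elementary measure
theory; RH-free; nothing here bears on the truth of RH.
-/

-- `Summit.RiemannHypothesis.RiemannHypothesis.…` repeats a component by the tree's layout (D-0017).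
set_option linter.dupNamespace false

noncomputable section

open Complex Filter Topology Set MeasureTheory

namespace Summit.RiemannHypothesis.RiemannHypothesis.Theorems

namespace ScrewFejerWindow

open Literature.NumberTheory.LFunctions Literature.NumberTheory.LFunctions.ZetaScrewLandau

/-! ### Plumbing: the back-shifted, cut-off copies `𝟙_{y > e^a} Ψ(log y − a)` of `Ψ∘log` -/

/-- `y ↦ 𝟙_{y > e^a} Ψ(log y − a)` is measurable. -/
theorem measurable_indicator_zetaScrew_log_sub (a : ℝ) :
    Measurable (fun y : ℝ ↦ (Ioi (Real.exp a)).indicator (fun y ↦ zetaScrew (Real.log y - a)) y) :=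
  (continuous_zetaScrew.measurable.comp (Real.measurable_log.sub_const a)).indicator measurableSet_Ioi

/-- The complex Mellin integrand `f(x) x^{-(s+1)}` is integrable on `(1, ∞)` as soon as the real one
converges absolutely at some `σ₁ < Re s` (the case `n = 0` of `Landau.integrable_mellinIntegrand`). -/
theorem integrable_ofReal_mul_cpow {f : ℝ → ℝ} (hf : Measurable f) {σ₁ : ℝ}
    (hint : IntegrableOn (fun x ↦ f x * x ^ (-(σ₁ + 1))) (Ioi 1)) {s : ℂ} (hs : σ₁ < s.re) :
    Integrable (fun x : ℝ ↦ ((f x : ℝ) : ℂ) * (x : ℂ) ^ (-(s + 1))) (volume.restrict (Ioi 1)) := by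
  have h := Landau.integrable_mellinIntegrand hf hint 0 (s := s) hs
  refine h.congr (Eventually.of_forall fun x ↦ ?_)
  simp [Landau.mellinIntegrand]

/-- For `a ≥ 0` and real `σ > 1/2`, the Mellin integrand of the shifted copy,
`𝟙_{y > e^a} Ψ(log y − a) · y^{-(σ+1)}`, is integrable on `(1, ∞)` (substitute `y = e^a x` in
Suzuki2023 Thm 1.1 (1), tree `integrableOn_zetaScrew_log_rpow`). -/
theorem integrableOn_indicator_zetaScrew_log_sub_rpow {a : ℝ} (ha : 0 ≤ a) {σ : ℝ}
    (hσ : 1 / 2 < σ) :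
    IntegrableOn (fun y : ℝ ↦ (Ioi (Real.exp a)).indicator (fun y ↦ zetaScrew (Real.log y - a)) y
      * y ^ (-(σ + 1))) (Ioi 1) := by
  have hea : 0 < Real.exp a := Real.exp_pos a
  have hea1 : 1 ≤ Real.exp a := Real.one_le_exp ha
  have h1 : (fun y : ℝ ↦ (Ioi (Real.exp a)).indicator (fun y ↦ zetaScrew (Real.log y - a)) y
      * y ^ (-(σ + 1)))
      = (Ioi (Real.exp a)).indicator (fun y ↦ zetaScrew (Real.log y - a) * y ^ (-(σ + 1))) := by
    funext y
    rw [Set.indicator_mul_left]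
  rw [h1, integrableOn_indicator_iff measurableSet_Ioi,
    Set.inter_eq_left.2 (Set.Ioi_subset_Ioi hea1)]
  have h2 : IntegrableOn (fun x : ℝ ↦ zetaScrew (Real.log x) * x ^ (-(σ + 1))) (Ioi 1) :=
    integrableOn_zetaScrew_log_rpow hσ
  have h2' : IntegrableOn (fun x : ℝ ↦ (Real.exp a) ^ (-(σ + 1))
      * (zetaScrew (Real.log x) * x ^ (-(σ + 1)))) (Ioi 1) := h2.const_mul _
  have h3 : IntegrableOn (fun x : ℝ ↦ zetaScrew (Real.log (Real.exp a * x) - a)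
      * (Real.exp a * x) ^ (-(σ + 1))) (Ioi 1) := by
    refine h2'.congr_fun (fun x hx ↦ ?_) measurableSet_Ioi
    have hx : 0 < x := lt_trans zero_lt_one hx
    rw [Real.log_mul hea.ne' hx.ne', Real.log_exp, add_sub_cancel_left, Real.mul_rpow hea.le hx.le]
    ring
  have h4 := (integrableOn_Ioi_comp_mul_left_iff
    (fun y : ℝ ↦ zetaScrew (Real.log y - a) * y ^ (-(σ + 1))) 1 hea).1 h3
  simpa using h4

/-- **The shift rule.**  For `a ≥ 0` and `Re s > 1/2`:
`∫_1^∞ 𝟙_{y > e^a} Ψ(log y − a) y^{-(s+1)} dy = e^{-as} ∫_1^∞ Ψ(log x) x^{-(s+1)} dx`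
(substitution `y = e^a x`; in the Laplace variable, `∫_a^∞ Ψ(t − a) e^{-st} dt = e^{-as} ∫_0^∞ Ψ e^{-st}`). -/
theorem mellinIoi_indicator_zetaScrew_log_sub {a : ℝ} (ha : 0 ≤ a) (s : ℂ) :
    Landau.mellinIoi (fun y : ℝ ↦ (Ioi (Real.exp a)).indicator (fun y ↦ zetaScrew (Real.log y - a)) y) s
      = cexp (-(a * s)) * Landau.mellinIoi (fun x : ℝ ↦ zetaScrew (Real.log x)) s := by
  have hea : 0 < Real.exp a := Real.exp_pos a
  have hea1 : 1 ≤ Real.exp a := Real.one_le_exp ha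
  unfold Landau.mellinIoi
  have h1 : ∀ y : ℝ,
      (((Ioi (Real.exp a)).indicator (fun y ↦ zetaScrew (Real.log y - a)) y : ℝ) : ℂ)
          * (y : ℂ) ^ (-(s + 1))
        = (Ioi (Real.exp a)).indicator
            (fun y : ℝ ↦ ((zetaScrew (Real.log y - a) : ℝ) : ℂ) * (y : ℂ) ^ (-(s + 1))) y := by
    intro y
    by_cases hy : y ∈ Ioi (Real.exp a)
    · rw [Set.indicator_of_mem hy, Set.indicator_of_mem hy]
    · rw [Set.indicator_of_notMem hy, Set.indicator_of_notMem hy]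
      simp
  simp_rw [h1]
  rw [setIntegral_indicator measurableSet_Ioi, Set.inter_eq_right.2 (Set.Ioi_subset_Ioi hea1)]
  have h2 := integral_comp_mul_left_Ioi
    (fun y : ℝ ↦ ((zetaScrew (Real.log y - a) : ℝ) : ℂ) * (y : ℂ) ^ (-(s + 1))) 1 hea
  rw [mul_one] at h2
  have h3 : ∫ y in Ioi (Real.exp a), ((zetaScrew (Real.log y - a) : ℝ) : ℂ) * (y : ℂ) ^ (-(s + 1))
      = (Real.exp a : ℝ) • ∫ x in Ioi (1 : ℝ),
          ((zetaScrew (Real.log (Real.exp a * x) - a) : ℝ) : ℂ)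
            * ((Real.exp a * x : ℝ) : ℂ) ^ (-(s + 1)) := by
    rw [h2, smul_smul, mul_inv_cancel₀ hea.ne', one_smul]
  rw [h3]
  have h4 : ∫ x in Ioi (1 : ℝ), ((zetaScrew (Real.log (Real.exp a * x) - a) : ℝ) : ℂ)
        * ((Real.exp a * x : ℝ) : ℂ) ^ (-(s + 1))
      = ∫ x in Ioi (1 : ℝ), ((Real.exp a : ℝ) : ℂ) ^ (-(s + 1))
          * (((zetaScrew (Real.log x) : ℝ) : ℂ) * (x : ℂ) ^ (-(s + 1))) := by
    refine setIntegral_congr_fun measurableSet_Ioi fun x hx ↦ ?_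
    have hx : 0 < x := lt_trans zero_lt_one hx
    have hl : Real.log (Real.exp a * x) - a = Real.log x := by
      rw [Real.log_mul hea.ne' hx.ne', Real.log_exp, add_sub_cancel_left]
    rw [hl, Complex.ofReal_mul, Complex.mul_cpow_ofReal_nonneg hea.le hx.le]
    ring
  rw [h4, integral_const_mul, Complex.real_smul, ← mul_assoc]
  congr 1
  rw [ofReal_exp_cpow, Complex.ofReal_exp, ← Complex.exp_add]
  congr 1
  ring

end ScrewFejerWindow

end Summit.RiemannHypothesis.RiemannHypothesis.Theorems

end
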